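import Summits.Ventures.HodgeRepro2.T5LandherrRankOne

/-!
# The cell's two Landherr displays are equivalent modulo the Hasse norm theorem: the converse display implication
(cell pub-hodge-repro2, seat p3)

Tier-5 N2 support, rows N2.2.7 / N2.2.9 / N2.8.1 of route/T5-N2-route-3.md; the converse of file 161. File 161
proves `GrossBH2021_Thm3_1_uniqueness K (Fin 2) → T6.Hyp.Shimura2008_Thm2_2_i K`; file 164 identifies the rank-one
instance `GrossBH2021_Thm3_1_uniqueness K (Fin 1)` with the Hasse norm theorem for `K/K⁺`. This file closes the
circle, with no new display:
* `exists_det_eq_mul_norm_of_grossBH2021_Fin1`: two Gram matrices congruent at every place have a determinant ratio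
  which is a global norm — the ratio `c ∈ K⁺` has `(c, θ)_v = 1` at every finite place and is positive under every
  embedding (file 156), so the rank-one display (file 164) applies;
* **`grossBH2021_Fin2_of_shimura`** — THE CONVERSE DISPLAY IMPLICATION: the rank-one display (the Hasse norm
  theorem) and `T6.Hyp.Shimura2008_Thm2_2_i K` together give `GrossBH2021_Thm3_1_uniqueness K (Fin 2)`: diagonalise
  both matrices (file 129), the diagonal forms have the same `d₀` and (file 163) the same sign sums at every
  embedding, so Shimura's classification (the display) gives an isometry of the `pairForm`s and file 157's bridge
  the congruence of the diagonal forms;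
* `grossBH2021_Fin1_of_Fin2`: the rank-two display gives the rank-one one (add a second diagonal entry `1`: at a
  finite place the local class depends on the determinant ratio only — file 156 — and at an embedding the sign sums
  agree — file 158);
* **`grossBH2021_Fin2_iff`** — `GrossBH2021_Thm3_1_uniqueness K (Fin 2) ↔ GrossBH2021_Thm3_1_uniqueness K (Fin 1) ∧
  T6.Hyp.Shimura2008_Thm2_2_i K`: the cell's two Landherr displays are equivalent modulo the Hasse norm theorem,
  which is the rank-one instance of the Hasse-principle display (file 164's `grossBH2021_Fin1_iff`). Nothing here is
  consumed by the M-chain (the composition of record takes N2 through the display-free `N2_main_explicit`); the file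
  serves the referees' faithfulness reading of the two displays (README §10.5 (i)): neither display is weaker or
  stronger than the other beyond exactly this printed theorem.

Mathlib + t6-p5's accepted T6N2Hyp (the display, consumed by name, never re-declared) + this seat's files 129 / 130 /
134 / 156–158 / 161 / 163 / 164 and their imports; no new display; no device. §8(d): uses an L-value-free
non-vanishing device: NO.
-/

namespace Summit.Ventures.HodgeRepro2.T5LandherrDisplaysEquiv

open Matrix NumberField NumberField.IsCMField IsDedekindDomain IsDedekindDomain.HeightOneSpectrum
open Summit.Ventures.HodgeRepro2.T5HermitianDetClass Summit.Ventures.HodgeRepro2.T5HermitianGlobalChain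
  Summit.Ventures.HodgeRepro2.T5GramIsometry Summit.Ventures.HodgeRepro2.T5GramSignature
  Summit.Ventures.HodgeRepro2.T5LandherrInvariants Summit.Ventures.HodgeRepro2.T5LandherrInvariantsIff
  Summit.Ventures.HodgeRepro2.T5HermitianDiagonalize Summit.Ventures.HodgeRepro2.T5HermitianClassify
  Summit.Ventures.HodgeRepro2.T5HilbertSymbolNorm Summit.Ventures.HodgeRepro2.T5HilbertSymbolPlaces
  Summit.Ventures.HodgeRepro2.T6.B1Carriers Summit.Ventures.HodgeRepro2.T5LandherrRankOne

/-! ## The converse display implication: rank one + Shimura's classification give rank two -/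

section Converse

variable {K : Type*} [Field K] [NumberField K] [IsCMField K]

/-- `μ + star μ ≠ 0` for `μ = 1` in a field of characteristic zero (file 129's diagonalisation input). -/
theorem one_add_star_one_ne_zero : ∃ μ : K, μ + star μ ≠ 0 :=
  ⟨1, by rw [star_one, one_add_one_eq_two]; exact two_ne_zero⟩

/-- **Two Gram matrices congruent at every place have a determinant ratio which is a global norm** — from the
rank-one display alone: the ratio `c ∈ K⁺` has `(c, θ)_v = 1` at every finite place (file 156) and is positive
under every embedding (file 156), so `exists_mul_star_eq_of_grossBH2021_Fin1` applies. -/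
theorem exists_det_eq_mul_norm_of_grossBH2021_Fin1 (hG1 : GrossBH2021_Thm3_1_uniqueness K (Fin 1))
    {n : Type*} [Fintype n] [DecidableEq n] {H H' : Matrix n n K}
    (hH : H.IsHermitian) (hH' : H'.IsHermitian) (hdet : IsUnit H.det) (hdet' : IsUnit H'.det)
    (hloc : ∀ v : HeightOneSpectrum (𝓞 (maximalRealSubfield K)), LocallyCongruent K v H H')
    (hreal : ∀ φ : K →+* ℂ, IsCongruent (H.map φ) (H'.map φ)) :
    ∃ z : K, z ≠ 0 ∧ H'.det = z * star z * H.det := by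
  obtain ⟨θ, y, hθ, hy⟩ := exists_datum K
  obtain ⟨d, hd⟩ : ∃ d : maximalRealSubfield K, algebraMap (maximalRealSubfield K) K d = H.det :=
    ⟨⟨H.det, det_mem_maximalRealSubfield hH⟩, rfl⟩
  obtain ⟨d', hd'⟩ : ∃ d' : maximalRealSubfield K, algebraMap (maximalRealSubfield K) K d' = H'.det :=
    ⟨⟨H'.det, det_mem_maximalRealSubfield hH'⟩, rfl⟩
  have hd0 : d ≠ 0 := by
    rintro rfl
    rw [map_zero] at hd
    exact hdet.ne_zero hd.symm
  have hd0' : d' ≠ 0 := by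
    rintro rfl
    rw [map_zero] at hd'
    exact hdet'.ne_zero hd'.symm
  have hc0 : d' / d ≠ 0 := div_ne_zero hd0' hd0
  have hc' : H'.det = algebraMap (maximalRealSubfield K) K (d' / d) * H.det := by
    rw [← hd, ← hd', map_div₀, div_mul_cancel₀ _ ((map_ne_zero _).mpr hd0)]
  have hfin : ∀ v : HeightOneSpectrum (𝓞 (maximalRealSubfield K)),
      hilbertFin (maximalRealSubfield K) v (d' / d) θ = 1 :=
    fun v => (hilbertFin_eq_one_iff_locallyCongruent hθ hy v hH hH' hdet hdet' hc0 hc').mpr (hloc v)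
  have hpos : ∀ φ : K →+* ℂ, 0 < (φ (algebraMap (maximalRealSubfield K) K (d' / d))).re :=
    fun φ => re_pos_of_isCongruent_map hdet hc' (φ.comp (algebraMap (maximalRealSubfield K) K)) φ rfl (hreal φ)
  obtain ⟨z, hz⟩ := exists_mul_star_eq_of_grossBH2021_Fin1 hθ hy hG1 hc0 hfin hpos
  have hz0 : z ≠ 0 := by
    rintro rfl
    rw [zero_mul, eq_comm, map_eq_zero] at hz
    exact hc0 hz
  exact ⟨z, hz0, by rw [hc', hz]⟩

omit [NumberField K] [IsCMField K] in
/-- A `2 × 2` diagonal matrix as `diagonal ![d 0, d 1]`. -/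
theorem diagonal_fin_two_eq (d : Fin 2 → K) : diagonal d = diagonal ![d 0, d 1] := by
  congr 1
  ext i
  fin_cases i <;> rfl

/-- **THE CONVERSE DISPLAY IMPLICATION — the rank-one display (the Hasse norm theorem) and Shimura's classification
give the rank-two Hasse principle:** two invertible hermitian `2 × 2` Gram matrices over `K`, congruent at every
finite place of `K⁺` and under every embedding `K → ℂ`, are congruent over `K`. Their determinant ratio is a global
norm (`exists_det_eq_mul_norm_of_grossBH2021_Fin1`); diagonalise both (file 129), the diagonal forms have the same
`d₀` and, by file 163, the same sign sums at every embedding, so `T6.Hyp.Shimura2008_Thm2_2_i K` gives an isometry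
of the `pairForm`s and file 157's bridge the congruence of the diagonal forms. -/
theorem grossBH2021_Fin2_of_shimura (hG1 : GrossBH2021_Thm3_1_uniqueness K (Fin 1))
    (hSh : Summit.Ventures.HodgeRepro2.T6.Hyp.Shimura2008_Thm2_2_i K) :
    GrossBH2021_Thm3_1_uniqueness K (Fin 2) := by
  intro H H' hH hH' hdet hdet' hloc hreal
  obtain ⟨z, hz0, hz⟩ := exists_det_eq_mul_norm_of_grossBH2021_Fin1 hG1 hH hH' hdet hdet' hloc hreal
  -- diagonalise: `H ≅ diag(d 0, d 1)`, `H' ≅ diag(d' 0, d' 1)`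
  obtain ⟨d, hds, hd0, hHD⟩ := exists_congruent_diagonal_ne_zero one_add_star_one_ne_zero H hH hdet
  obtain ⟨d', hds', hd0', hHD'⟩ := exists_congruent_diagonal_ne_zero one_add_star_one_ne_zero H' hH' hdet'
  rw [diagonal_fin_two_eq] at hHD hHD'
  -- the determinants of the diagonal forms
  obtain ⟨u, hu, hdu⟩ := hHD.exists_det_eq
  obtain ⟨u', hu', hdu'⟩ := hHD'.exists_det_eq
  have hdetD : (diagonal ![d 0, d 1]).det = d 0 * d 1 := by
    rw [det_diagonal, Fin.prod_univ_two]
    simp only [Matrix.cons_val_zero, Matrix.cons_val_one]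
  have hdetD' : (diagonal ![d' 0, d' 1]).det = d' 0 * d' 1 := by
    rw [det_diagonal, Fin.prod_univ_two]
    simp only [Matrix.cons_val_zero, Matrix.cons_val_one]
  -- same determinant class: `d' 0 * d' 1 = d 0 * d 1 * w w̄` with `w = u' z / u`
  have hu0 : u ≠ 0 := hu.ne_zero
  have hu0' : u' ≠ 0 := hu'.ne_zero
  have hsu0 : star u ≠ 0 := star_ne_zero.mpr hu0
  have hnorm : ∃ w : K, w ≠ 0 ∧ d' 0 * d' 1 = d 0 * d 1 * (w * star w) := by
    refine ⟨u' * z * u⁻¹, mul_ne_zero (mul_ne_zero hu0' hz0) (inv_ne_zero hu0), ?_⟩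
    rw [← hdetD, ← hdetD', hdu', hdu, hz, star_mul, star_mul, star_inv₀]
    field_simp
  -- equal sign sums at every embedding
  have hsign : ∀ φ : K →+* ℂ,
      (SignType.sign (φ (d' 0)).re : ℤ) + SignType.sign (φ (d' 1)).re =
        (SignType.sign (φ (d 0)).re : ℤ) + SignType.sign (φ (d 1)).re := by
    intro φ
    refine sign_add_eq_of_isCongruent_map φ (hds' 0) (hds' 1) (hds 0) (hds 1) (hd0' 0) (hd0' 1) (hd0 0) (hd0 1) ?_
    exact ((isCongruent_map_of_isCongruent φ hHD).symm.trans (hreal φ)).trans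
      (isCongruent_map_of_isCongruent φ hHD')
  -- Shimura's classification gives the isometry, file 157 the congruence of the diagonal forms
  have hDD' : IsCongruent (diagonal ![d 0, d 1]) (diagonal ![d' 0, d' 1]) :=
    isCongruent_diagonal_of_exists_isometry_pairForm
      (hSh (d' 0) (d' 1) (d 0) (d 1) (hds' 0) (hds' 1) (hds 0) (hds 1) (hd0' 0) (hd0' 1) (hd0 0) (hd0 1)
        hnorm hsign)
  exact (hHD.trans hDD').trans hHD'.symm

/-- **The rank-two display gives the rank-one one:** for `(a)`, `(a')` congruent at every place, the `2 × 2`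
matrices `diag(a, 1)`, `diag(a', 1)` are congruent at every place too (at a finite place the local class depends
on the determinant ratio only — file 156; at an embedding, the sign sums agree — file 158), so they are congruent
over `K` and the determinant ratio `a'/a` is a norm. -/
theorem grossBH2021_Fin1_of_Fin2 (hG2 : GrossBH2021_Thm3_1_uniqueness K (Fin 2)) :
    GrossBH2021_Thm3_1_uniqueness K (Fin 1) := by
  intro H H' hH hH' hdet hdet' hloc hreal
  obtain ⟨θ, y, hθ, hy⟩ := exists_datum K
  -- the entries `a = det H`, `a' = det H'` lie in `K⁺`
  obtain ⟨d, hd⟩ : ∃ d : maximalRealSubfield K, algebraMap (maximalRealSubfield K) K d = H.det :=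
    ⟨⟨H.det, det_mem_maximalRealSubfield hH⟩, rfl⟩
  obtain ⟨d', hd'⟩ : ∃ d' : maximalRealSubfield K, algebraMap (maximalRealSubfield K) K d' = H'.det :=
    ⟨⟨H'.det, det_mem_maximalRealSubfield hH'⟩, rfl⟩
  have hd0 : d ≠ 0 := by
    rintro rfl
    rw [map_zero] at hd
    exact hdet.ne_zero hd.symm
  have hd0' : d' ≠ 0 := by
    rintro rfl
    rw [map_zero] at hd'
    exact hdet'.ne_zero hd'.symm
  have hc0 : d' / d ≠ 0 := div_ne_zero hd0' hd0
  have hc' : H'.det = algebraMap (maximalRealSubfield K) K (d' / d) * H.det := by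
    rw [← hd, ← hd', map_div₀, div_mul_cancel₀ _ ((map_ne_zero _).mpr hd0)]
  have hfin : ∀ v : HeightOneSpectrum (𝓞 (maximalRealSubfield K)),
      hilbertFin (maximalRealSubfield K) v (d' / d) θ = 1 :=
    fun v => (hilbertFin_eq_one_iff_locallyCongruent hθ hy v hH hH' hdet hdet' hc0 hc').mpr (hloc v)
  have hpos : ∀ φ : K →+* ℂ, 0 < (φ (algebraMap (maximalRealSubfield K) K (d' / d))).re :=
    fun φ => re_pos_of_isCongruent_map hdet hc' (φ.comp (algebraMap (maximalRealSubfield K) K)) φ rfl (hreal φ)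
  -- the `2 × 2` matrices `diag(det H, 1)`, `diag(det H', 1)`
  set a : K := H.det with ha
  set a' : K := H'.det with ha'
  have hsa : star a = a := T5HermitianDetClass.IsHermitian.star_det hH
  have hsa' : star a' = a' := T5HermitianDetClass.IsHermitian.star_det hH'
  have ha0 : a ≠ 0 := hdet.ne_zero
  have ha0' : a' ≠ 0 := hdet'.ne_zero
  have hH₂ : (diagonal ![a, 1]).IsHermitian := by
    refine isHermitian_diagonal_iff.mpr fun i => ?_
    fin_cases i
    · exact hsa
    · exact star_one K
  have hH₂' : (diagonal ![a', 1]).IsHermitian := by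
    refine isHermitian_diagonal_iff.mpr fun i => ?_
    fin_cases i
    · exact hsa'
    · exact star_one K
  have hdet₂ : (diagonal ![a, 1]).det = a := by
    rw [det_diagonal, Fin.prod_univ_two]
    simp only [Matrix.cons_val_zero, Matrix.cons_val_one, mul_one]
  have hdet₂' : (diagonal ![a', 1]).det = a' := by
    rw [det_diagonal, Fin.prod_univ_two]
    simp only [Matrix.cons_val_zero, Matrix.cons_val_one, mul_one]
  have hudet₂ : IsUnit (diagonal ![a, 1]).det := by rw [hdet₂]; exact hdet
  have hudet₂' : IsUnit (diagonal ![a', 1]).det := by rw [hdet₂']; exact hdet'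
  have hc₂ : (diagonal ![a', 1]).det = algebraMap (maximalRealSubfield K) K (d' / d) * (diagonal ![a, 1]).det := by
    rw [hdet₂, hdet₂']
    exact hc'
  have hloc₂ : ∀ v : HeightOneSpectrum (𝓞 (maximalRealSubfield K)),
      LocallyCongruent K v (diagonal ![a, 1]) (diagonal ![a', 1]) :=
    fun v => (hilbertFin_eq_one_iff_locallyCongruent hθ hy v hH₂ hH₂' hudet₂ hudet₂' hc0 hc₂).mp (hfin v)
  have hreal₂ : ∀ φ : K →+* ℂ, IsCongruent ((diagonal ![a, 1]).map φ) ((diagonal ![a', 1]).map φ) := by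
    intro φ
    refine isCongruent_map_of_sign_add φ hsa' (star_one K) hsa (star_one K) ha0' one_ne_zero ha0 one_ne_zero ?_
    -- `sign (φ a') = sign (φ a)`: `φ a' = φ (d'/d) · φ a` with `φ (d'/d) > 0`
    have hpa : (φ a').re = (φ (algebraMap (maximalRealSubfield K) K (d' / d))).re * (φ a).re := by
      have h3 : φ a' = φ (algebraMap (maximalRealSubfield K) K (d' / d)) * φ a := by
        rw [hc', map_mul]
      have h1 : (((φ a).re : ℝ) : ℂ) = φ a := ofReal_re_eq φ hsa
      have h2 : (((φ (algebraMap (maximalRealSubfield K) K (d' / d))).re : ℝ) : ℂ) =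
          φ (algebraMap (maximalRealSubfield K) K (d' / d)) :=
        ofReal_re_eq φ (complexConj_apply_eq_self K (d' / d))
      have h4 : (((φ a').re : ℝ) : ℂ) =
          (((φ (algebraMap (maximalRealSubfield K) K (d' / d))).re * (φ a).re : ℝ) : ℂ) := by
        rw [Complex.ofReal_mul, h1, h2, ofReal_re_eq φ hsa', h3]
      exact Complex.ofReal_injective h4
    rw [hpa, sign_mul, sign_pos (hpos φ), one_mul]
  obtain ⟨u, hu, hdu⟩ := (hG2 _ _ hH₂ hH₂' hudet₂ hudet₂' hloc₂ hreal₂).exists_det_eq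
  rw [hdet₂, hdet₂'] at hdu
  exact isCongruent_of_unique ⟨u, hu.ne_zero, hdu⟩

/-- **THE CELL'S TWO LANDHERR DISPLAYS ARE EQUIVALENT MODULO THE HASSE NORM THEOREM:**
`GrossBH2021_Thm3_1_uniqueness K (Fin 2)` holds iff `GrossBH2021_Thm3_1_uniqueness K (Fin 1)` (the Hasse norm
theorem for `K/K⁺`, `grossBH2021_Fin1_iff`) and `T6.Hyp.Shimura2008_Thm2_2_i K` both hold — `⇒` by file 161's
display implication and `grossBH2021_Fin1_of_Fin2`, `⇐` by `grossBH2021_Fin2_of_shimura`. -/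
theorem grossBH2021_Fin2_iff :
    GrossBH2021_Thm3_1_uniqueness K (Fin 2) ↔
      GrossBH2021_Thm3_1_uniqueness K (Fin 1) ∧ Summit.Ventures.HodgeRepro2.T6.Hyp.Shimura2008_Thm2_2_i K :=
  ⟨fun hG2 => ⟨grossBH2021_Fin1_of_Fin2 hG2, shimura2008_Thm2_2_i_of_grossBH2021 hG2⟩,
    fun ⟨hG1, hSh⟩ => grossBH2021_Fin2_of_shimura hG1 hSh⟩

end Converse

end Summit.Ventures.HodgeRepro2.T5LandherrDisplaysEquiv
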